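/-
Copyright: audit package `pub-balaban` (b2b), unit `b2b-balaban-pv09-g11` (SURGE NODE PROVER #09, gen 11).
Released under the licence of the host repository.
-/
import Literature.MathematicalPhysics.QuantumFieldTheory.Balaban1983to89.B6Cov2156TorusDelK

/-!
# Bałaban 1984 (Propagators II, CMP 96), (2.153): the constraint «QB = 0» — b06 ∕ pv09's (2.125) reading `q1`
# IS β ∕ B5's averaging operator `QvOp` of (1.18) (k = 1), and (2.153) for the genuine Δ_k under `QvOp … = 0`

T. Bałaban, *Propagators and renormalization transformations for lattice gauge theories. II*,
Commun. Math. Phys. **96** (1984) 223–250 (= [Balaban1984PropagatorsII]), p. 245 [PDF 23] formula (2.125) and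
p. 249 [PDF 27] formula (2.153); T. Bałaban, *Propagators and renormalization transformations for lattice gauge
theories. I*, Commun. Math. Phys. **95** (1984) 17–40 (= [Balaban1984PropagatorsI]), p. 20 [PDF 4], formula (1.18).

## The audited sentences (verbatim, read from the page images this session)

[Balaban1984PropagatorsII] p. 249 [PDF 27] (render `…1984-cmp96-propagators-rt-II-p027-x2.png`): «Using (2.118) and
(2.128) we get ⟨B, Δ_kB⟩ ≧ (γ₀/12d²)L^{−d−1}‖B‖², or Δ_k ≧ (γ₀/12d²)L^{−d−1} (2.153) on the subspace of B
satisfying: QB = 0, B(Γ_{y,x}) = 0 for x ∈ B(y).» and, same page: «Next we remove the variables B_{b₀}, where b₀ is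
a bond belonging to B(c) for some c ∈ Λ′, and contained in c, using the δ-functions δ((QB)(c)).»

[Balaban1984PropagatorsII] p. 245 [PDF 23] (render `…-p023-x2.png`; the figure labels the coarse bond c with
c₋ = y, c₊ = y + Le_μ and its block B(c)): «We identify B(b) = B_μ(x) for b = ⟨x, x + e_μ⟩, and we have …
|(Q₁B)(c)|² = |Σ_{x∈B(c₋)} L^{−(d+1)}B([x, x + Le_μ])|² = …  (2.125)» (first equality only; the rest of (2.125) is
quoted in `B6Lemma24PrintedShape`).

[Balaban1984PropagatorsI] p. 20 [PDF 4] (render `…1984-cmp95-propagators-rt-I-p004-x2.png`): «(Q_kA)_b =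
Σ_{x∈B^k(b₋)} η^{d+1}A([x, x(b)]), b ⊂ T₁^{(k)} = Z^d ∩ T_η, η = L^{−k}, (1.18) and x(b) is a point in B^k(b₊)
obtained from x by translation by b. If b = ⟨y, y + e_μ⟩, then x(b) = x + e_μ.»

## What this module certifies — ONE JUNCTION (torus model; every d, every L ≥ 1, every coarse torus M′)

The package types the «QB = 0» of (2.153) TWICE, in two lineages that never met:
* b06 ∕ pv09 (the (2.128)→(2.153)→(2.157) line): `B6Lemma24PrintedShape.q1 L B c = Σ_{x∈B(c₋)} L^{−(d+1)}·
  Σ_{s<L} B(x + se_μ, μ)` — (2.125) first equality transcribed on ℤ^d — and, on the torus of side M = L·M′,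
  the constraint `∀ c ∈ faces L M, q1 L (perExt M B) c = 0` inside `B6Cov2156Torus.LowerOnConstrainedT` (the
  hypothesis shape of (2.153) for which `B6Cov2156TorusDelK.lowerOnConstrainedT_reDelK_sharp` proves (2.153) for the
  genuine (1.65) operator, γ₀ = 1).  `B6Lemma24Carrier.q1Term` records: «that this is B5 (1.8)'s Q₁ under (2.121)
  is not asserted».
* β ∕ B5 (the block renormalization line): `B5Block118.QvOp n M′ : Matrix (Tor M′ × Fin d) (Tor (n·M′) × Fin d) ℂ`
  — (1.18) as a matrix, `QvOp_mulVec : (Q A)(y, μ) = n^{−(d+1)} Σ_j Σ_{t<n} A(n·y + j + t e_μ, μ)` — the operator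
  the whole β cell averages with (`Beta.FluctuationProjection.QGQ`, `Beta.BlockEffectiveAction.DelK = (QGQ*)⁻¹ − a`).

PROVED HERE (zero `sorry`; finite bookkeeping — [folklore] junctions; NO printed statement enters as a hypothesis,
ABSOLUTE RULE):
* §1 lattice geometry of the block: `bpt_add_tstep_eq` — for y ∈ LZ^d the fine torus point `bpt L M′ (y/L) j +
  tstep μ t` IS the class of `y + j + t·e_μ` in `Tor (L·M′)`; `sum_block_eq` — Σ_{x∈B(y)} = Σ_{j∈{0,…,L−1}^d} (y + j);
  `perExt_eq_ofBox_toT`; the coarse-site dictionary `csite L M′ : Tor M′ → LZ^d ∩ box` (`csite_mem_coarseSites`,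
  `toT_csite_div`).
* §2 **THE DICTIONARY**: `QvOp_ofBox_apply` — ENTRYWISE, for every real field B on the bonds of the box of side
  L·M′ and every coarse bond c = ⟨y, y + Le_μ⟩ (y ∈ LZ^d):
  `(QvOp L M′ *ᵥ B̃) (y/L, μ) = ((q1 L (perExt (L·M′) B) (y, μ) : ℝ) : ℂ)` with B̃ = `ofRealCfg _ (ofBox _ B)` (B
  read on the torus bonds, in ℂ); `QvOp_ofBox_apply'` (indexed by `Tor M′`); and the constraint equivalence
  **`qConstraint_iff : QvOp L M′ *ᵥ B̃ = 0 ↔ ∀ c ∈ faces L (L·M′), q1 L (perExt _ B) c = 0`**.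
* §3 the (2.153) hypothesis shape WITH THE β-CELL CONSTRAINT, `LowerOnConstrainedQ L M′ Δ γ` (verbatim
  `LowerOnConstrainedT` with «QB = 0» read as `QvOp L M′ *ᵥ B̃ = 0`), and **`lowerOnConstrainedQ_iff :
  LowerOnConstrainedQ L M′ Δ γ ↔ LowerOnConstrainedT L (L·M′) Δ γ`** for EVERY operator Δ and constant γ.
* §4 for the genuine (1.65) operator: **`lowerOnConstrainedQ_reDelK_sharp`** (d ≥ 2, n ≥ 1):
  ⟨B, (Re Δ_k)B⟩ ≥ (1/12d²)L^{−d−1}‖B‖² on {`QvOp L M′ *ᵥ B̃ = 0`, B(Γ_{y,x}) = 0} (← `lowerOnConstrainedT_reDelK_sharp`),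
  and the torus-native complex form **`lower2153_DelK_of_QvOp`**: for every REAL field F on `Tor (L·M′) × Fin d` with
  `QvOp L M′ *ᵥ F̃ = 0` and F = 0 on the tree bonds, `(1/12d²)L^{−d−1}·Σ_s F(s)² ≤ Re(F̃ᴴ·Δ_k·F̃)` with
  `Im(F̃ᴴ·Δ_k·F̃) = 0` (`form_DelK_ofRealCfg_im`) — Δ_k = `Beta.BlockEffectiveAction.DelK n hn (L·M′) a ha` itself.

HONEST SCOPE.  (i) Torus model, as in both lineages: fine bonds `Tor (L·M′) × Fin d` (the unit lattice T^{(k)} of the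
(k+1)-st step, side L·M′_μ in direction μ), coarse bonds `Tor M′ × Fin d`; n = L^k ≥ 1 (the level inside Δ_k) is a free
parameter independent of the blocking factor L of the step.  (ii) Which Q: p. 249 writes «QB = 0» and «δ((QB)(c))»,
c ∈ Λ′ a coarse bond, without restating Q; b06 typed it via (2.125)'s Q₁ (same paper, p. 245), β via (1.18) (k = 1);
THIS FILE PROVES THE TWO TYPED READINGS COINCIDE on the torus — it does not adjudicate the print beyond that, and the
scaling conventions (unit lattice with L-blocks vs. η-lattice, η = L^{−1}) do not enter the index-level matrices except
through the common prefactor L^{−(d+1)}.  (iii) The tree constraint «B(Γ_{y,x}) = 0 for x ∈ B(y)» stays in b06's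
vocabulary (`B6BondElimination.IsTree L (coarseSites L M)` on the bonds of the box, transported by `idxEquiv`); its
identification with the β cell's axial-gauge objects (`Beta.AxialProjector`, `Beta.GaugeFixing`) is NOT asserted here.
(iv) NOT claimed: anything about (2.154)–(2.157) beyond what `B6Cov2156TorusDelK` already proves (they follow by
rewriting with `lowerOnConstrainedQ_iff`), the Gaussian integral, β, Proposition 1.2, the continuum limit.  Value = a
junction certificate closing BY NAME the recorded non-assertion of `B6Lemma24Carrier.q1Term` ∕ the informal gloss of
`B6Lemma24PrintedShape.q1` («= B5 (1.18) with k = 1») for the typed torus objects, so that (2.153) for the genuine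
Δ_k is available under the β cell's own constraint operator; NOT summit progress; NOT the continuum limit; NOT Clay.

Imported BY NAME, none edited: `…B6Cov2156TorusDelK` (pv09-g11, v1.1 p191073; hence `B6Cov2156Torus`,
`B6LowerBound2153Torus`, `B6Lemma24Torus`, `B6Lemma24PrintedShape`, `B6BondElimination`, `B5Block118`,
`B5Prop11Plancherel`, `B5Bounds167Lattice`, `Beta.BlockEffectiveAction`).
Unit `b2b-balaban-pv09-g11` (SURGE NODE PROVER #09, gen 11), node G-B6-2153-Q-QVOP-DICT (GAPS C-pv09g11-3); staged
byte-identically under `HOME/lean/BalabanYm4/`.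
-/

noncomputable section

open scoped BigOperators Matrix
open Finset Matrix

namespace Literature.MathematicalPhysics.QuantumFieldTheory.Balaban1983to89.B6Constraint2153QvOp

open B6BondElimination (IsTree unitVec unitVec_apply)
open B6Elimination (mem_block)
open B6Lemma24PrintedShape (q1 segSum)
open B6Lemma24Torus (pbox mem_pbox coarseSites mem_coarseSites coarseSites_dvd faces mem_faces)
open B6LowerBound2153Torus (toT rep rep_mem_pbox toT_rep lift lift_apply)
open B6Cov2156Torus (perExt ofBox lift_ofBox LowerOnConstrainedT)
open B6Cov2156TorusDelK (idxEquiv ofBox_apply ofBox_idxEquiv reDelK gamma2153one lowerOnConstrainedT_reDelK_sharp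
  quad_reDelK_complex)
open B5Prop11Plancherel (Tor fine)
open B5Block118 (QvOp QvOp_mulVec lineSum bpt up iota tstep upHom_intCast)
open B5Bounds167Lattice (ofRealCfg)
open Beta.BlockEffectiveAction (DelK)

variable {d : ℕ}

/-! ## §1  Lattice geometry of the block: coarse sites y ∈ LZ^d ↔ `Tor M′`, fine points y + j + t·e_μ ↔ `bpt … + tstep …` -/

section Geometry

variable (L : ℕ) [NeZero L] (M' : Fin d → ℕ) [∀ μ, NeZero (M' μ)]

omit [∀ μ, NeZero (M' μ)] in
/-- For y ∈ LZ^d, the fine torus point `L·(y/L) + j + t e_μ` of `B5Block118` IS the class of `y + j + t e_μ` in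
`Tor (L·M′)`. [folklore] -/
theorem bpt_add_tstep_eq (y : Fin d → ℤ) (hy : ∀ i, (L : ℤ) ∣ y i) (j : Fin d → Fin L) (μ : Fin d) (t : ℕ) :
    bpt L M' (toT M' (fun i => y i / L)) j + tstep (fine L M') μ t
      = toT (fine L M') (y + (fun i => ((j i : ℕ) : ℤ)) + (t : ℤ) • unitVec μ) := by
  funext ν
  simp only [bpt, up, iota, tstep, toT, Pi.add_apply, Pi.smul_apply, smul_eq_mul, unitVec_apply]
  rw [upHom_intCast]
  obtain ⟨q, hq⟩ := hy ν
  rw [hq, Int.mul_ediv_cancel_left _ (by exact_mod_cast (NeZero.ne L))]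
  push_cast
  split_ifs <;> simp

/-- The periodic extension of a box field IS the box field read on the torus, composed with the quotient map.
[folklore] -/
theorem perExt_eq_ofBox_toT (B : B4.Idx (pbox (fine L M')) d → ℝ) (z : Fin d → ℤ) (μ : Fin d) :
    perExt (fine L M') B (z, μ) = ofBox (fine L M') B (toT (fine L M') z, μ) := by
  rw [← lift_ofBox, lift_apply]

omit [∀ μ, NeZero (M' μ)] in
/-- The block B(y) = y + {0,…,L−1}^d as an image: Σ_{x ∈ B(y)} f(x) = Σ_{j ∈ {0,…,L−1}^d} f(y + j). [folklore] -/
theorem sum_block_eq (y : Fin d → ℤ) (f : (Fin d → ℤ) → ℂ) :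
    ∑ x ∈ B6Elimination.block L y, f x = ∑ j : Fin d → Fin L, f (y + fun i => ((j i : ℕ) : ℤ)) := by
  have hL : 0 < L := Nat.pos_of_ne_zero (NeZero.ne L)
  refine (Finset.sum_nbij' (fun j => y + fun i => ((j i : ℕ) : ℤ))
    (fun x => fun i => ⟨(x i - y i).toNat % L, Nat.mod_lt _ hL⟩) ?_ ?_ ?_ ?_ ?_).symm
  · intro j _
    rw [mem_block]
    intro i
    simp only [Pi.add_apply]
    constructor
    · linarith [Int.natCast_nonneg (j i : ℕ)]
    · have := (j i).isLt
      linarith [show ((j i : ℕ) : ℤ) < L from by exact_mod_cast this]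
  · intro x _
    exact mem_univ _
  · intro j _
    funext i
    apply Fin.ext
    simp only [Pi.add_apply, add_sub_cancel_left, Int.toNat_natCast]
    exact Nat.mod_eq_of_lt (j i).isLt
  · intro x hx
    rw [mem_block] at hx
    funext i
    simp only [Pi.add_apply]
    have h1 : 0 ≤ x i - y i := by linarith [(hx i).1]
    have h2 : x i - y i < L := by linarith [(hx i).2]
    have h3 : ((x i - y i).toNat : ℤ) = x i - y i := Int.toNat_of_nonneg h1
    have h4 : (x i - y i).toNat < L := by
      have := h3 ▸ h2; exact_mod_cast this
    rw [Nat.mod_eq_of_lt h4, h3]; ring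
  · intro j _
    rfl

/-- The coarse site of ℤ^d (in LZ^d ∩ box of side L·M′) representing a point of the coarse torus `Tor M′`:
y′ ↦ L·rep(y′). [folklore] -/
def csite (y' : Tor M') : Fin d → ℤ := fun i => (L : ℤ) * rep M' y' i

omit [NeZero L] [∀ μ, NeZero (M' μ)] in
/-- Its coordinates are multiples of L. [folklore] -/
theorem csite_dvd (y' : Tor M') : ∀ i, (L : ℤ) ∣ csite L M' y' i := fun _ => Dvd.intro _ rfl

/-- It lies in `coarseSites L (L·M′)` = LZ^d ∩ [0, L·M′). [folklore] -/
theorem csite_mem_coarseSites (y' : Tor M') : csite L M' y' ∈ coarseSites L (fine L M') := by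
  have hL : (0 : ℤ) < L := by exact_mod_cast Nat.pos_of_ne_zero (NeZero.ne L)
  have hr := (mem_pbox (M := M')).1 (rep_mem_pbox M' y')
  refine mem_coarseSites.2 ⟨(mem_pbox (M := fine L M')).2 fun i => ⟨?_, ?_⟩, csite_dvd L M' y'⟩
  · exact mul_nonneg hL.le (hr i).1
  · have h2 := (hr i).2
    simp only [csite, fine]
    push_cast
    exact Int.mul_lt_mul_of_pos_left h2 hL

/-- … on the face set: (csite y′, μ) ∈ `faces L (L·M′)`. [folklore] -/
theorem csite_mem_faces (y' : Tor M') (μ : Fin d) : (csite L M' y', μ) ∈ faces L (fine L M') :=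
  mem_faces.2 (csite_mem_coarseSites L M' y')

/-- … and dividing by L gives back the class: `toT M′ (csite y′ / L) = y′`. [folklore] -/
theorem toT_csite_div (y' : Tor M') : toT M' (fun i => csite L M' y' i / L) = y' := by
  have hL : (L : ℤ) ≠ 0 := by exact_mod_cast NeZero.ne L
  have : (fun i => csite L M' y' i / L) = rep M' y' := by
    funext i
    simp only [csite]
    rw [Int.mul_ediv_cancel_left _ hL]
  rw [this, toT_rep]

end Geometry

/-! ## §2  THE DICTIONARY: `(QvOp L M′ *ᵥ B̃)(y/L, μ) = (Q₁B^per)(⟨y, y + Le_μ⟩)` and `QvOp … = 0 ↔ ∀ c ∈ faces, q1 … c = 0` -/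

section Dictionary

variable (L : ℕ) [NeZero L] (M' : Fin d → ℕ) [∀ μ, NeZero (M' μ)]

/-- **THE CONSTRAINT DICTIONARY, ENTRYWISE: `(Q B̃)(c) = (Q₁B^per)(c)`** — β ∕ B5's averaging operator `QvOp L M′`
((1.18) with k = 1, `B5Block118`) applied to a real box field read on the torus bonds (in ℂ) equals b06 ∕ pv09's
printed (2.125) functional `q1` of the periodic extension, at the coarse bond c = ⟨y, y + Le_μ⟩, y ∈ LZ^d (class
`y/L` in `Tor M′`). [folklore] (junction of [cite: Balaban1984PropagatorsI, (1.18) p.20] and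
[cite: Balaban1984PropagatorsII, (2.125) p.245] as typed) -/
theorem QvOp_ofBox_apply (B : B4.Idx (pbox (fine L M')) d → ℝ) (y : Fin d → ℤ) (hy : ∀ i, (L : ℤ) ∣ y i)
    (μ : Fin d) :
    (QvOp L M' *ᵥ ofRealCfg (fine L M') (ofBox (fine L M') B)) (toT M' (fun i => y i / L), μ)
      = ((q1 L (perExt (fine L M') B) (y, μ) : ℝ) : ℂ) := by
  rw [QvOp_mulVec, q1, Complex.ofReal_sum]
  simp only [Complex.ofReal_mul, Complex.ofReal_inv, Complex.ofReal_pow, Complex.ofReal_natCast, segSum,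
    Complex.ofReal_sum]
  rw [sum_block_eq L (y := y), Finset.mul_sum]
  refine Finset.sum_congr rfl fun j _ => ?_
  rw [one_div, lineSum, Finset.sum_range (fun t => ((perExt (fine L M') B
    (y + (fun i => ((j i : ℕ) : ℤ)) + (t : ℤ) • unitVec μ, μ) : ℝ) : ℂ))]
  congr 1
  refine Finset.sum_congr rfl fun t _ => ?_
  rw [bpt_add_tstep_eq L M' y hy j μ t, ofRealCfg, ← perExt_eq_ofBox_toT]

/-- The same, indexed by the coarse torus: `(QvOp L M′ *ᵥ B̃)(y′, μ) = (Q₁B^per)(⟨L·rep y′, L·rep y′ + Le_μ⟩)`.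
[folklore] -/
theorem QvOp_ofBox_apply' (B : B4.Idx (pbox (fine L M')) d → ℝ) (y' : Tor M') (μ : Fin d) :
    (QvOp L M' *ᵥ ofRealCfg (fine L M') (ofBox (fine L M') B)) (y', μ)
      = ((q1 L (perExt (fine L M') B) (csite L M' y', μ) : ℝ) : ℂ) := by
  have h := QvOp_ofBox_apply L M' B (csite L M' y') (csite_dvd L M' y') μ
  rwa [toT_csite_div] at h

/-- **THE CONSTRAINT «QB = 0» OF (2.153), BOTH TYPED READINGS COINCIDE**: β's `QvOp L M′ *ᵥ B̃ = 0` ↔ b06 ∕ pv09's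
`(Q₁B^per)(c) = 0 at every coarse bond c` of the torus of side L·M′. [folklore]
(readings of [cite: Balaban1984PropagatorsII, (2.153) p.249]) -/
theorem qConstraint_iff (B : B4.Idx (pbox (fine L M')) d → ℝ) :
    QvOp L M' *ᵥ ofRealCfg (fine L M') (ofBox (fine L M') B) = 0 ↔
      ∀ c ∈ faces L (fine L M'), q1 L (perExt (fine L M') B) c = 0 := by
  constructor
  · intro h c hc
    have hy : ∀ i, (L : ℤ) ∣ c.1 i := coarseSites_dvd c.1 (mem_faces.1 hc)
    have key := QvOp_ofBox_apply L M' B c.1 hy c.2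
    rw [h, Pi.zero_apply] at key
    exact_mod_cast key.symm
  · intro h
    funext s
    obtain ⟨y', μ⟩ := s
    rw [Pi.zero_apply, QvOp_ofBox_apply' L M' B y' μ, h _ (csite_mem_faces L M' y' μ), Complex.ofReal_zero]

end Dictionary

/-! ## §3  The hypothesis shape of (2.153) with the β-cell constraint, and its equivalence with `LowerOnConstrainedT` -/

section Shape

variable (L : ℕ) [NeZero L] (M' : Fin d → ℕ) [∀ μ, NeZero (M' μ)]

/-- THE HYPOTHESIS SHAPE of (2.153) ON THE TORUS of side L·M′, «QB = 0» read with β ∕ B5's (1.18) operator: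
for every real field B on the bond variables with `QvOp L M′ *ᵥ B̃ = 0` and B = 0 on the tree bonds of every block,
γ‖B‖² ≤ ⟨B, ΔB⟩ — verbatim `B6Cov2156Torus.LowerOnConstrainedT` except for the reading of Q.
[cite: Balaban1984PropagatorsII, (2.153) p.249] -/
def LowerOnConstrainedQ (Δ : Matrix (B4.Idx (pbox (fine L M')) d) (B4.Idx (pbox (fine L M')) d) ℝ) (γ : ℝ) :
    Prop :=
  ∀ B : B4.Idx (pbox (fine L M')) d → ℝ, QvOp L M' *ᵥ ofRealCfg (fine L M') (ofBox (fine L M') B) = 0 →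
    (∀ p, IsTree L (coarseSites L (fine L M')) p → B p = 0) → γ * ∑ p, B p ^ 2 ≤ ∑ p, B p * (Δ *ᵥ B) p

/-- **The two hypothesis shapes of (2.153) are EQUIVALENT, for every operator Δ and every constant γ.** [folklore] -/
theorem lowerOnConstrainedQ_iff (Δ : Matrix (B4.Idx (pbox (fine L M')) d) (B4.Idx (pbox (fine L M')) d) ℝ)
    (γ : ℝ) : LowerOnConstrainedQ L M' Δ γ ↔ LowerOnConstrainedT L (fine L M') Δ γ := by
  unfold LowerOnConstrainedQ LowerOnConstrainedT
  refine forall_congr' fun B => ?_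
  rw [qConstraint_iff]

end Shape

/-! ## §4  (2.153) for the genuine (1.65) operator Δ_k under the β-cell constraint `QvOp L M′ *ᵥ B̃ = 0` -/

section DelK

variable (L : ℕ) [NeZero L] (M' : Fin d → ℕ) [∀ μ, NeZero (M' μ)]

omit [NeZero L] [∀ μ, NeZero (M' μ)] in
/-- L ∣ L·M′_i. [folklore] -/
theorem dvd_fine (i : Fin d) : L ∣ fine L M' i := Dvd.intro _ rfl

/-- **KERNEL-CHECKED — (2.153) ON THE TORUS FOR THE GENUINE Δ_k, «QB = 0» READ WITH β's `QvOp`, γ₀ = 1**: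
⟨B, (Re Δ_k)B⟩ ≥ (1/12d²)L^{−d−1}‖B‖² for every real B with `QvOp L M′ *ᵥ B̃ = 0` and B(Γ_{y,x}) = 0 (x ∈ B(y)) —
d ≥ 2, L ≥ 1, n ≥ 1, torus of side L·M′ (← `B6Cov2156TorusDelK.lowerOnConstrainedT_reDelK_sharp` + §3).
[cite: Balaban1984PropagatorsII, (2.153) p.249; Balaban1984PropagatorsI, (1.18) p.20, (1.65) p.29 (γ₀ = 1 ours)] -/
theorem lowerOnConstrainedQ_reDelK_sharp (hd : 2 ≤ d) (n : ℕ) (hn : 1 ≤ n) :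
    LowerOnConstrainedQ L M' (reDelK n hn (fine L M')) (gamma2153one d L) :=
  (lowerOnConstrainedQ_iff L M' _ _).2
    (lowerOnConstrainedT_reDelK_sharp (M := fine L M') hd (Nat.one_le_iff_ne_zero.2 (NeZero.ne L)) n hn
      (dvd_fine L M'))

/-- For a REAL field F on the torus bonds the complex number F̃ᴴ·Δ_k·F̃ is real. [folklore] -/
theorem form_DelK_ofRealCfg_im (n : ℕ) [NeZero n] (hn : 1 ≤ n) (a : ℝ) (ha : 0 < a)
    (F : Tor (fine L M') × Fin d → ℝ) :
    (star (ofRealCfg (fine L M') F) ⬝ᵥ (DelK n hn (fine L M') a ha *ᵥ ofRealCfg (fine L M') F)).im = 0 := by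
  have hFB : ofBox (fine L M') (fun p => F (idxEquiv (fine L M') p)) = F := by
    funext s; rw [ofBox_apply, Equiv.apply_symm_apply]
  rw [← hFB, ← quad_reDelK_complex n hn (fine L M') a ha, Complex.ofReal_im]

/-- **KERNEL-CHECKED — (2.153) FOR Δ_k ITSELF, TORUS-NATIVE**: for every REAL field F on `Tor (L·M′) × Fin d` with
`QvOp L M′ *ᵥ F̃ = 0` ((1.18), k = 1) and F = 0 on the tree bonds Γ_{y,x} of every L-block,
`(1/12d²)L^{−d−1} · Σ_s F(s)² ≤ Re(F̃ᴴ · Δ_k · F̃)` where Δ_k = `Beta.BlockEffectiveAction.DelK n hn (L·M′) a ha` is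
the genuine (1.65) operator (its form on real fields is real, `form_DelK_ofRealCfg_im`); d ≥ 2, n ≥ 1, any dummy
a > 0 (`DelK_indep`). [cite: Balaban1984PropagatorsII, (2.153) p.249; Balaban1984PropagatorsI, (1.18) p.20,
(1.65) p.29 (γ₀ = 1 ours)] -/
theorem lower2153_DelK_of_QvOp (hd : 2 ≤ d) (n : ℕ) [NeZero n] (hn : 1 ≤ n) (a : ℝ) (ha : 0 < a)
    (F : Tor (fine L M') × Fin d → ℝ)
    (hQ : QvOp L M' *ᵥ ofRealCfg (fine L M') F = 0)
    (hT : ∀ p : B4.Idx (pbox (fine L M')) d,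
      IsTree L (coarseSites L (fine L M')) p → F (idxEquiv (fine L M') p) = 0) :
    gamma2153one d L * ∑ s, F s ^ 2
      ≤ (star (ofRealCfg (fine L M') F) ⬝ᵥ (DelK n hn (fine L M') a ha *ᵥ ofRealCfg (fine L M') F)).re := by
  set B : B4.Idx (pbox (fine L M')) d → ℝ := fun p => F (idxEquiv (fine L M') p) with hB
  have hFB : ofBox (fine L M') B = F := by
    funext s; simp only [hB, ofBox_apply, Equiv.apply_symm_apply]
  have h1 := lowerOnConstrainedQ_reDelK_sharp L M' hd n hn B (by rw [hFB]; exact hQ) hT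
  have h2 : ∑ p, B p ^ 2 = ∑ s, F s ^ 2 :=
    Fintype.sum_equiv (idxEquiv (fine L M')) _ _ (fun p => rfl)
  have h3 : ((∑ p, B p * (reDelK n hn (fine L M') *ᵥ B) p : ℝ) : ℂ)
      = star (ofRealCfg (fine L M') F) ⬝ᵥ (DelK n hn (fine L M') a ha *ᵥ ofRealCfg (fine L M') F) := by
    rw [quad_reDelK_complex n hn (fine L M') a ha B, hFB]
  have h4 : ∑ p, B p * (reDelK n hn (fine L M') *ᵥ B) p
      = (star (ofRealCfg (fine L M') F) ⬝ᵥ (DelK n hn (fine L M') a ha *ᵥ ofRealCfg (fine L M') F)).re := by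
    rw [← h3, Complex.ofReal_re]
  rw [← h2, ← h4]
  exact h1

/-- The printed constant: `gamma2153one d L = (1/12d²)·L^{−(d+1)}` (γ₀ = 1). [cite: Balaban1984PropagatorsII,
(2.153) p.249 (γ′₀ = (γ₀/12d²)L^{−d−1})] -/
theorem gamma2153one_eq (d L : ℕ) :
    gamma2153one d L = 1 / (12 * (d : ℝ) ^ 2) * (L : ℝ) ^ (-((d : ℝ) + 1)) := rfl

end DelK

end Literature.MathematicalPhysics.QuantumFieldTheory.Balaban1983to89.B6Constraint2153QvOp
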